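/-
Copyright (c) 2026. All rights reserved.
Released under Apache 2.0 license as described in the file LICENSE.
Authors: abc-iut cell, prover seat abc-iut-L4-d2 (gen 6).
-/
import Literature.AnabelianGeometry.AbsoluteAnabelian.GaloisTheatersNumberFieldShadow
import Literature.AnabelianGeometry.AbsoluteAnabelian.ProfiniteVirtualChartsRat
import Literature.AnabelianGeometry.AbsoluteAnabelian.NeukirchUchidaTransportToF
import HarnessLib

/-!
# [AbsTopIII] Def 5.1 (ii)/(iii): the `GlobalAnabelianContext` TERM at the number-field arithmetic shadow

S. Mochizuki, *Topics in absolute anabelian geometry III* [MochizukiAbsTopIII2015], Def 5.1 (ii) pp. 113–114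
("the data functorially constructed from `Π_X`": `Δ_X`, `k_NF(Π_X) ≅ F̄`, `V⊚(Π_X)`, `X(Π_X, v)`, `δ_{ell,v}`,
`κ_{ell,v}`) and (iii) p. 115 (morphisms of `EA⊚` = "open injections of profinite groups"; `V⊚(−)` is
functorial in them).  The cell typed (ii) as the INTERFACE structure `GlobalAnabelianContext`
(`GaloisTheaters.lean`, abc-iut-L4-t3, FROZEN p407762) whose functoriality fields `mapProVal`,
`mapProVal_smul`, `mapKNF` quantify over ALL extensions `E₁ E₂ : FundamentalExtension` and every
`IsEAHom f` (the «total binder», census HOME/staging/L4/abc-iut-L4-d2/gen4/COR52III-CONTEXT-CENSUS.md §6).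
The def-bearing file `GaloisTheatersNumberFieldShadow.lean` (abc-iut-L4-d2 g4) built every OTHER field at
the number-field ARITHMETIC SHADOW (`E_F = (G_F →(id) G_F)`, `Δ = 1`) and left the TERM unassembled: the
total binder is a global choice problem equivalent to «slimness of `G_ℚ` + Neukirch–Uchida over `ℚ` for all
open subgroups» — both now THEOREMS of the tree (`neukirchUchida_holds`,
`NeukirchUchidaProof.existsUnique_conj_of_continuousMulEquiv`).

THIS FILE ASSEMBLES THE TERM `NumberFieldShadow.context F : GlobalAnabelianContext.{0}` by the
**`ℚ`-CHART / COMMENSURATOR construction** (`ProfiniteVirtualCharts*.lean`):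

* a `ℚ`-chart of a profinite `Π` is a continuous homomorphism `Π →ₜ* Γ := G_ℚ` injective with open image
  on some open subgroup; «`Π` admits a `ℚ`-chart» (`HasRatChart`) is INVARIANT along every morphism of
  `EA⊚` in both directions (`hasRatChart_iff_of_isEAHom`), and any two charts are `Γ`-conjugate;
* `ratChart E` := a CHOSEN chart of `Π_E` (the trivial homomorphism on the chartless component);
  `E_F` is charted by abc-iut-w6-d055's `j_F : G_F ↪ Γ` (`hasRatChart_extension`), hence so is every
  admissible `E` (`hasRatChart_of_isAdmissible`), and `ratChart E_F` is `j_F` up to an inner automorphism of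
  `Γ` (`exists_ratChart_extension_eq_conj`);
* `V⊚(Π_E)` := the GENUINE valuation pro-set `V⊚(ℚ̄/ℚ)` of abc-iut-L4-d2 g4 (`NumberField.valuationProSet ℚ`;
  the places of `ℚ̄ ≅ F̄` — `V⊚(F̄/F)` does not depend on `F`) with `Π_E` acting through `ratChart E`;
  `k_NF(Π_E)` := `ℚ̄` through `ratChart E`;
* `mapProVal f` := translation by the CONJUGATOR `τ_f ∈ Γ` of the two charts `ratChart E₁`,
  `ratChart E₂ ∘ f` of `Π₁` (`ratChart_comp_eq_conj`; `τ_f = 1` on the chartless component, where both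
  actions are trivial) — equivariance `mapProVal_smul` is then the action axiom; `mapKNF f := τ_f` as a
  field automorphism of `ℚ̄`;
* the archimedean data are the honest STUBS of g4 (point orbispace, `A := ℂ`, `π₁^∧ := Δ_E`, `δ := id`,
  `κ_{ell,v}` = the GENUINE complex embedding of the place under `v`);
* `NumberFieldShadow.theater F : GlobalGaloisTheater (context F)` — the shadow theater at `E_F` with
  reference isomorphism `id` (so `GlobalGaloisTheater (context F)` is INHABITED).

HONEST LABEL: this is the ARITHMETIC SHADOW (`Δ = 1`, stub archimedean geometry), NOT print's `EA⊚` of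
elliptically admissible hyperbolic orbicurves (no étale `π₁` in the tree; campaign-L, cell E-list E-L4-13);
the node [AbsTopIII] Cor 5.2 (iii) stays PARTIAL at node level.  What is GENUINE: `G_F`, `V⊚(ℚ̄/ℚ)` with its
Galois action and decomposition groups, `k_NF = ℚ̄`, the complex embeddings, and the functoriality in ALL
open injections — unconditionally (Neukirch–Uchida is a theorem of the tree).  The print-faithful
admissible-restricted successor type is abc-iut-L4-t3's «ADM-CONTEXT» (a term of it follows from this one by
restriction).  No `instance`/`notation`/attribute changes; nothing here bears on [IUTchIII] Cor. 3.12 or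
takes a side; shadow ≠ print's instance; typed ≠ proved.
-/

noncomputable section

open scoped Pointwise Topology Classical
open CategoryTheory NumberField Field

namespace Literature.AnabelianGeometry.AbsoluteAnabelian

open NeukirchUchidaProof

namespace NumberFieldShadow

/-! ### `ℚ`-charts of the arithmetic fundamental group `Π_E` -/

/-- «`Π_E` admits a `ℚ`-chart»: there is a continuous homomorphism `Π_E →ₜ* G_ℚ` that is injective with
open image on some open subgroup of `Π_E` (true for every `E` reachable from `E_F` by morphisms of `EA⊚`).
[cite: MochizukiAbsTopIII2015, Def 5.1 (iii) p.115] -/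
def HasRatChart (E : FundamentalExtension.{0}) : Prop :=
  ∃ m : E.arith →ₜ* absoluteGaloisGroup ℚ,
    ∃ W : Subgroup E.arith, IsOpen (W : Set E.arith) ∧ Set.InjOn m W ∧ IsOpen (m '' W)

/-- The CHOSEN `ℚ`-chart `Π_E →ₜ* G_ℚ` (the trivial homomorphism if `Π_E` admits none).
[cite: MochizukiAbsTopIII2015, Def 5.1 (ii) p.114] -/
def ratChart (E : FundamentalExtension.{0}) : E.arith →ₜ* absoluteGaloisGroup ℚ :=
  if h : HasRatChart E then Classical.choose h else 1

/-- The chosen chart IS a `ℚ`-chart when one exists. [cite: MochizukiAbsTopIII2015, Def 5.1 (ii) p.114] -/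
theorem ratChart_spec {E : FundamentalExtension.{0}} (h : HasRatChart E) :
    ∃ W : Subgroup E.arith, IsOpen (W : Set E.arith) ∧ Set.InjOn (ratChart E) W ∧
      IsOpen (ratChart E '' W) := by
  rw [ratChart, dif_pos h]
  exact Classical.choose_spec h

/-- On the chartless component the chosen chart is trivial. [cite: MochizukiAbsTopIII2015, Def 5.1 (ii) p.114] -/
theorem ratChart_of_not {E : FundamentalExtension.{0}} (h : ¬ HasRatChart E) : ratChart E = 1 := by
  rw [ratChart, dif_neg h]

/-- **«admits a `ℚ`-chart» is invariant along every morphism of `EA⊚`, in both directions** (charts pull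
back along, and — by the commensurator construction over Neukirch–Uchida + slimness of `G_ℚ` — extend along
open injections of profinite groups). [cite: MochizukiAbsTopIII2015, Def 5.1 (iii) p.115] -/
theorem hasRatChart_iff_of_isEAHom {E₁ E₂ : FundamentalExtension.{0}} (f : E₁ ⟶ E₂) (hf : IsEAHom f) :
    HasRatChart E₁ ↔ HasRatChart E₂ :=
  VirtualChart.Rat.exists_chart_iff_of_openInjective f.arith hf.injective hf.isOpen_range

/-- Along a morphism of `EA⊚` from a charted object, the two charts `ratChart E₂ ∘ f` and `ratChart E₁` of
`Π₁` are conjugate in `G_ℚ`. [cite: NeukirchSchmidtWingberg2008, Thm (12.2.1)] -/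
theorem exists_conjugator {E₁ E₂ : FundamentalExtension.{0}} (f : E₁ ⟶ E₂) (hf : IsEAHom f)
    (h₁ : HasRatChart E₁) :
    ∃ τ : absoluteGaloisGroup ℚ, ∀ g : E₁.arith,
      ratChart E₂ (f.arith g) = τ * ratChart E₁ g * τ⁻¹ :=
  VirtualChart.Rat.exists_conj_of_charts (ratChart E₁) ((ratChart E₂).comp f.arith) (ratChart_spec h₁)
    (VirtualChart.Rat.chart_comp_of_openInjective f.arith hf.injective hf.isOpen_range _
      (ratChart_spec ((hasRatChart_iff_of_isEAHom f hf).mp h₁)))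

/-- The CONJUGATOR `τ_f ∈ G_ℚ` of a morphism of `EA⊚` (chosen; `1` on the chartless component).
[cite: MochizukiAbsTopIII2015, Def 5.1 (iii) p.115] -/
def conjugator {E₁ E₂ : FundamentalExtension.{0}} (f : E₁ ⟶ E₂) (hf : IsEAHom f) :
    absoluteGaloisGroup ℚ :=
  if h₁ : HasRatChart E₁ then Classical.choose (exists_conjugator f hf h₁) else 1

/-- **The chart-transition law** (uniformly on both components): `ratChart E₂ ∘ f = τ_f · ratChart E₁ · τ_f⁻¹`.
[cite: MochizukiAbsTopIII2015, Def 5.1 (iii) p.115] -/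
theorem ratChart_comp_eq_conj {E₁ E₂ : FundamentalExtension.{0}} (f : E₁ ⟶ E₂) (hf : IsEAHom f)
    (g : E₁.arith) :
    ratChart E₂ (f.arith g) = conjugator f hf * ratChart E₁ g * (conjugator f hf)⁻¹ := by
  by_cases h₁ : HasRatChart E₁
  · rw [conjugator, dif_pos h₁]
    exact Classical.choose_spec (exists_conjugator f hf h₁) g
  · have h₂ : ¬ HasRatChart E₂ := fun h => h₁ ((hasRatChart_iff_of_isEAHom f hf).mpr h)
    rw [conjugator, dif_neg h₁, ratChart_of_not h₁, ratChart_of_not h₂]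
    simp

/-! ### `E_F` and the admissible objects are charted -/

variable (F : Type) [Field F] [NumberField F]

/-- **`E_F` admits a `ℚ`-chart**: abc-iut-w6-d055's `j_F : G_F ↪ G_ℚ` (`absGaloisToRatOfField`, injective,
open image). [cite: NeukirchSchmidtWingberg2008, Thm (12.2.1)] -/
theorem hasRatChart_extension : HasRatChart (extension F) := by
  refine ⟨absGaloisToRatOfField F, ⊤, isOpen_univ, (absGaloisToRatOfField_injective F).injOn, ?_⟩
  have h := isOpen_map_absGaloisToRatOfField F ⊤ isOpen_univ
  rwa [Subgroup.coe_map] at h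

/-- **Every admissible object admits a `ℚ`-chart** (transport along the admissibility isomorphism).
[cite: MochizukiAbsTopIII2015, Def 5.1 (ii) p.114] -/
theorem hasRatChart_of_isAdmissible {E : FundamentalExtension.{0}} (h : IsAdmissible F E) : HasRatChart E := by
  obtain ⟨e⟩ := h
  obtain ⟨m, hm⟩ := hasRatChart_extension F
  refine ⟨m.comp e.hom.arith, VirtualChart.Rat.chart_comp_of_openInjective e.hom.arith ?_ ?_ m hm⟩
  · exact (AbsTopI.isoArith e).injective
  · rw [show Set.range e.hom.arith = Set.univ from (AbsTopI.isoArith e).surjective.range_eq]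
    exact isOpen_univ

/-- The chosen chart of `E_F` is `j_F` up to an inner automorphism of `G_ℚ` — so the action of `G_F` on
`V⊚(ℚ̄/ℚ)` through `ratChart E_F` is the genuine Galois action up to the choice of `ℚ̄ ≅ F̄`.
[cite: NeukirchSchmidtWingberg2008, Thm (12.2.1)] -/
theorem exists_ratChart_extension_eq_conj :
    ∃ τ : absoluteGaloisGroup ℚ, ∀ σ : (extension F).arith,
      ratChart (extension F) σ = τ * absGaloisToRatOfField F σ * τ⁻¹ := by
  have h := hasRatChart_extension F
  refine VirtualChart.Rat.exists_conj_of_charts (absGaloisToRatOfField F) (ratChart (extension F)) ?_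
    (ratChart_spec h)
  refine ⟨⊤, isOpen_univ, (absGaloisToRatOfField_injective F).injOn, ?_⟩
  have h := isOpen_map_absGaloisToRatOfField F ⊤ isOpen_univ
  rwa [Subgroup.coe_map] at h

/-! ### The fields of the context -/

/-- `V⊚(Π_E)`: the GENUINE valuation pro-set `V⊚(ℚ̄/ℚ)` (places of `ℚ̄ ≅ F̄`, plus `⊚`) with `Π_E` acting
through its `ℚ`-chart. [cite: MochizukiAbsTopIII2015, Def 5.1 (ii) p.114] -/
def contextProVal (E : FundamentalExtension.{0}) : GaloisProSet E.arith :=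
  (NumberField.valuationProSet ℚ).comap (ratChart E)

/-- **`V⊚(f)`** for a morphism `f` of `EA⊚`: translation by the conjugator `τ_f ∈ G_ℚ` on `V⊚(ℚ̄/ℚ)`
(a self-homeomorphism). [cite: MochizukiAbsTopIII2015, Def 5.1 (iii) p.115] -/
def contextMapProVal {E₁ E₂ : FundamentalExtension.{0}} (f : E₁ ⟶ E₂) (hf : IsEAHom f) :
    (contextProVal E₁).carrier ≃ₜ (contextProVal E₂).carrier :=
  (Homeomorph.smul (conjugator f hf) :
    (NumberField.valuationProSet ℚ).carrier ≃ₜ (NumberField.valuationProSet ℚ).carrier)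

/-- **`V⊚(f)` is equivariant along `Π₁ ↪ Π₂`** — the chart-transition law read through the action.
[cite: MochizukiAbsTopIII2015, Def 5.1 (iii) p.115] -/
theorem contextMapProVal_smul {E₁ E₂ : FundamentalExtension.{0}} (f : E₁ ⟶ E₂) (hf : IsEAHom f)
    (g : E₁.arith) (v : (contextProVal E₁).carrier) :
    contextMapProVal f hf (g • v) = f.arith g • contextMapProVal f hf v := by
  letI := (NumberField.valuationProSet ℚ).action
  change conjugator f hf • (ratChart E₁ g • (show (NumberField.valuationProSet ℚ).carrier from v)) =
    ratChart E₂ (f.arith g) • (conjugator f hf • (show (NumberField.valuationProSet ℚ).carrier from v))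
  rw [ratChart_comp_eq_conj f hf g, mul_smul, mul_smul, inv_smul_smul]

/-- `V⊚(f)` fixes the global element `⊚`. [cite: MochizukiAbsTopIII2015, Def 5.1 (iii) p.115] -/
theorem contextMapProVal_generic {E₁ E₂ : FundamentalExtension.{0}} (f : E₁ ⟶ E₂) (hf : IsEAHom f) :
    contextMapProVal f hf (contextProVal E₁).generic = (contextProVal E₂).generic := by
  change conjugator f hf • (NumberField.valuationProSet ℚ).generic = (NumberField.valuationProSet ℚ).generic
  exact (NumberField.valuationProSet ℚ).smul_generic _

/-- `k_NF(Π_E) := ℚ̄` with `Π_E` acting through its `ℚ`-chart by the genuine Galois action.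
[cite: MochizukiAbsTopIII2015, Def 5.1 (ii) p.114] -/
@[reducible] def contextAction (E : FundamentalExtension.{0}) : MulSemiringAction E.arith (AlgebraicClosure ℚ) :=
  MulSemiringAction.compHom (AlgebraicClosure ℚ) (ratChart E).toMonoidHom

/-- **`k_NF(f)`**: the conjugator `τ_f` as a field automorphism of `ℚ̄`.
[cite: MochizukiAbsTopIII2015, Def 5.1 (iii) p.115] -/
def contextMapKNF {E₁ E₂ : FundamentalExtension.{0}} (f : E₁ ⟶ E₂) (hf : IsEAHom f) :
    AlgebraicClosure ℚ ≃+* AlgebraicClosure ℚ :=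
  (absoluteGaloisGroup.toAlgEquiv ℚ (conjugator f hf)).toRingEquiv

/-- `k_NF(f)` intertwines the actions of `Π₁` and `Π₂` on `ℚ̄`. [cite: MochizukiAbsTopIII2015, Def 5.1 (iii) p.115] -/
theorem contextMapKNF_smul {E₁ E₂ : FundamentalExtension.{0}} (f : E₁ ⟶ E₂) (hf : IsEAHom f)
    (g : E₁.arith) (x : AlgebraicClosure ℚ) :
    contextMapKNF f hf (letI := contextAction E₁; g • x) =
      (letI := contextAction E₂; f.arith g • contextMapKNF f hf x) := by
  change conjugator f hf • (ratChart E₁ g • x) = ratChart E₂ (f.arith g) • (conjugator f hf • x)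
  rw [ratChart_comp_eq_conj f hf g, mul_smul, mul_smul, inv_smul_smul]

/-- `X(Π_E, v)`: the STUB Aut-holomorphic orbispace (a point, `A_X := ℂ`, `π₁^∧ := Δ_E`; NO geometry).
[cite: MochizukiAbsTopIII2015, Def 5.1 (ii) p.114] -/
def contextArchSpace (E : FundamentalExtension.{0}) (_v : (contextProVal E).arc) : AutHolOrbispace.{0} where
  carrier := PUnit
  fieldA := ℂ
  pi1Hat := E.geomGrp

/-- `δ_{ell,v}`: the identity `Δ_E ≅ π₁^∧ := Δ_E`. [cite: MochizukiAbsTopIII2015, Def 5.1 (ii) p.114] -/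
def contextDelta (E : FundamentalExtension.{0}) (v : (contextProVal E).arc) :
    E.geom ≃ₜ* (contextArchSpace E v).pi1Hat :=
  ContinuousMulEquiv.refl _

/-- The infinite place of `ℚ̄` under an archimedean local element. [cite: MochizukiAbsTopIII2015, Def 5.1 (i) p.113] -/
def contextArcPlace (E : FundamentalExtension.{0}) (v : (contextProVal E).arc) :
    InfinitePlace (AlgebraicClosure ℚ) :=
  Classical.choose v.2

/-- `contextArcPlace` recovers `v`. [cite: MochizukiAbsTopIII2015, Def 5.1 (i) p.113] -/
theorem inr_inr_contextArcPlace (E : FundamentalExtension.{0}) (v : (contextProVal E).arc) :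
    (Sum.inr (Sum.inr (contextArcPlace E v)) : NumberFieldValuationProSet.Carrier ℚ) = v.1 :=
  Classical.choose_spec v.2

/-- `κ_{ell,v} : k_NF(Π_E) = ℚ̄ ↪ A_X = ℂ`: the GENUINE complex embedding of the place under `v`.
[cite: MochizukiAbsTopIII2015, Def 5.1 (ii) p.114] -/
def contextKappa (E : FundamentalExtension.{0}) (v : (contextProVal E).arc) :
    AlgebraicClosure ℚ →+* (contextArchSpace E v).fieldA :=
  (contextArcPlace E v).embedding

/-- `κ_{ell,v}` induces the place under `v`. [cite: MochizukiAbsTopIII2015, Def 5.1 (ii) p.114] -/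
theorem mk_contextKappa (E : FundamentalExtension.{0}) (v : (contextProVal E).arc) :
    InfinitePlace.mk (contextKappa E v) = contextArcPlace E v :=
  InfinitePlace.mk_embedding _

/-! ### The context term -/

/-- **The `GlobalAnabelianContext` of [AbsTopIII] Def 5.1 (ii) at the number-field ARITHMETIC SHADOW of
`F`, assembled under the CURRENT (total) functoriality binder**: admissible objects = extensions isomorphic
to `E_F = (G_F →(id) G_F)`; `geom_isMax` = [AbsAnab] Thm 1.1.2 (F-0031, proved); `k_NF := ℚ̄`,
`V⊚ := V⊚(ℚ̄/ℚ)` (genuine) through `ℚ`-charts; `mapProVal`/`mapKNF` := conjugators (Neukirch–Uchida +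
slimness of `G_ℚ`, proved); archimedean data = stubs.  SHADOW (`Δ = 1`), NOT print's `Π_X`.
[cite: MochizukiAbsTopIII2015, Def 5.1 (ii) p.114] -/
def context : GlobalAnabelianContext.{0} where
  IsAdmissible := IsAdmissible F
  isAdmissible_of_iso := fun ⟨e⟩ h => isAdmissible_of_iso F e h
  geom_isMax := fun _ h => isMaxTopFGClosedNormal_geom_of_isAdmissible F h
  kNF := fun _ => AlgebraicClosure ℚ
  instField := fun _ => inferInstance
  instAction := contextAction
  proVal := contextProVal
  archSpace := contextArchSpace
  δell := contextDelta
  κell := contextKappa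
  mapProVal := fun f hf => contextMapProVal f hf
  mapProVal_smul := fun f hf g v => contextMapProVal_smul f hf g v
  mapKNF := fun f hf => contextMapKNF f hf

/-- The context's admissibility predicate is the shadow admissibility. [cite: MochizukiAbsTopIII2015, Def 5.1 (ii) p.114] -/
theorem context_isAdmissible_iff (E : FundamentalExtension.{0}) :
    (context F).IsAdmissible E ↔ IsAdmissible F E :=
  Iff.rfl

/-- `E_F` is admissible for the context. [cite: MochizukiAbsTopIII2015, Def 5.1 (ii) p.114] -/
theorem context_isAdmissible_extension : (context F).IsAdmissible (extension F) :=
  isAdmissible_extension F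

/-! ### The shadow theater: `GlobalGaloisTheater (context F)` is inhabited -/

/-- **The global Galois-theater of the shadow at `E_F`** := the context's canonical theater `V⊚(E_F)`
(global Galois group `G_F`, the pro-set `V⊚(E_F)` itself, the context's own archimedean data, reference
isomorphism `id` — `GlobalAnabelianContext.theater`), so `GlobalGaloisTheater (context F)` is INHABITED.
[cite: MochizukiAbsTopIII2015, Def 5.1 (iii) p.115] -/
@[reducible] def theater : GlobalGaloisTheater (context F) :=
  (context F).theater (extension F) (isAdmissible_extension F)

/-- The theater's global Galois group is `G_F`. [cite: MochizukiAbsTopIII2015, Def 5.1 (iii) p.115] -/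
theorem theater_grp : (theater F).grp = absoluteGaloisGrp F := rfl

end NumberFieldShadow

end Literature.AnabelianGeometry.AbsoluteAnabelian

end
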